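import Summits.HodgeConjecture.CorCM.GaloisDihedralTimesTwoClassification
import Summits.HodgeConjecture.CorCM.CyclicAsymmetricCMHalvesTimesTwoMixed
import Summits.HodgeConjecture.CorCM.GaloisDihedralDegenerateTypes
import HarnessLib

/-!
# The family `Gal(K/ℚ) ≅ D_{2n} × C₂` for EVERY central involution: with `c = (rⁿ, z)` or `c = (1, z)` all simple CM
# abelian varieties are nondegenerate ⟺ `n = 1`; combined: ⟺ `n = 1 ∨ (n = 2 ∧ c = (r², 1))`

COR-CM (cell `pub-hodgecm2`), binder seat b04 (gen 22), count-neutral claim GALOIS-DIHEDRAL, part VI-c — completes part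
VI (`CorCM/GaloisDihedralTimesTwoClassification`, the involution `c = (rⁿ, 1)`: good ⟺ `n ≤ 2`).  KERNEL ONLY: theorems;
no definition, no named fact, no `sorry`.  `HC_CM` is neither used nor claimed.

`G₀ = DihedralGroup (2n) × Multiplicative (ZMod 2)` (order `8n`).  For `n ≥ 2` its central involutions are `(rⁿ, 1)`,
`(1, z)`, `(rⁿ, z)` (§3 `central_involution_cases`, from part III `eq_r_of_central_involution`); for `n = 1`
(`G₀ = C₂³`, degree `8`) every CM type is nondegenerate whatever `c` is.  For `c = (rⁿ, z) = ρ(n, 1)` and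
`c = (1, z) = ρ(0, 1)` the field `K` has an imaginary quadratic subfield (`D_{2n} × 1` avoids `c`), and:
* `n ≥ 4` (§1): the mirror types of part V on the aperiodic asymmetric CM halves of part VI-b are PRIMITIVE and
  DEGENERATE;
* `n = 2, 3` (§1): kernel-decided certificates on `D₄ × C₂` (ranks `7` of `9`) and `D₆ × C₂` (ranks `10`, `11` of `13`);
* hence (§2) GOOD ⟺ ALL-X ⟺ `n = 1` for these two involutions, and (§3, with part VI) for an ARBITRARY model
  `e : Gal(K/ℚ) ≃* D_{2n} × C₂`: every simple abelian variety with CM by `K` is nondegenerate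
  ⟺ `n = 1 ∨ (n = 2 ∧ e(c) = (r², 1))` (**`forall_isSimple_isNondegenerate_iff_dihedral₂_all`**).

## References

* [Shimura1998] G. Shimura, *Abelian Varieties with Complex Multiplication and Modular Functions*, §5.1 Prop. 3,
  §6.2 Thm. 3, §8.2 Prop. 26, §18.2 Lemma (i).
* [Gordon1999HodgeAVSurvey] B. B. Gordon, *A survey of the Hodge conjecture for abelian varieties*, Thm. 6.4, Def. 7.6,
  §9.3.
* [Dodson1984] B. Dodson, *The structure of Galois groups of CM-fields*, Trans. AMS 283 (1984), §3.1.1, §3.3.2.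
-/

noncomputable section

open CategoryTheory CategoryTheory.Limits NumberField

namespace Summit.HodgeConjecture.CorCM.GaloisDihedralTimesTwo

open Literature.NumberTheory.ComplexMultiplication
open Literature.AlgebraicGeometry Literature.AlgebraicGeometry.Motives Literature.AlgebraicGeometry.HodgeTheory
open Literature.AlgebraicGeometry.Motives.AbelianVariety
open Literature.AlgebraicGeometry.ComplexMultiplication
open Literature.AlgebraicGeometry.Pohlmann1968
open Summit.HodgeConjecture.CorCM.GaloisRank
open Summit.HodgeConjecture.CorCM.GaloisModels
open Summit.HodgeConjecture.CorCM.AbelianSixteen (exists_simple_realisation_of_isPrimitive)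
open Summit.HodgeConjecture.CorCM.CyclicAsymmetricHalvesTimesTwo
open DihedralGroup

variable {K : Type} [Field K] [NumberField K] [IsCMField K] [IsGalois ℚ K]
variable {n : ℕ}

/-! ## §1 Primitive degenerate CM types for `c = (rⁿ, z)` and `c = (1, z)` -/

/-- **`c = (rⁿ, z)`, `n ≥ 4`**: a primitive degenerate CM type (mirror type on the half of part VI-b for `h = (n, 1)`).
[cite: Shimura1998, §8.2 Prop. 26] [cite: Gordon1999HodgeAVSurvey, §9.3] -/
theorem exists_isPrimitive_not_isNondegenerate_dihedral₂B_of_four_le (hn : 4 ≤ n)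
    (e : (K ≃ₐ[ℚ] K) ≃* DihedralGroup (2 * n) × Multiplicative (ZMod 2))
    (hc : e ((IsCMField.complexConj K).restrictScalars ℚ) = (r (n : ZMod (2 * n)), Multiplicative.ofAdd 1))
    (φ₀ : K →+* ℂ) : ∃ Φ : CMType K, IsPrimitive (ℂ ≃+* ℂ) Φ.1 φ₀ ∧ ¬ IsNondegenerate Φ := by
  haveI : NeZero n := ⟨by omega⟩
  obtain ⟨S, hS⟩ := exists_halfB n
  have hc' : e ((IsCMField.complexConj K).restrictScalars ℚ) =
      (r ((((n : ℕ) : ZMod (2 * n)), (1 : ZMod 2)) : ZMod (2 * n) × ZMod 2).1,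
        Multiplicative.ofAdd ((((n : ℕ) : ZMod (2 * n)), (1 : ZMod 2)) : ZMod (2 * n) × ZMod 2).2) := by
    rw [hc]
  exact exists_isPrimitive_not_isNondegenerate_of_mirror₂ e _ hc' S 0 (halfB_mem_iff_add_not_mem (by omega) hS)
    (fun j hj => halfB_aperiodic (by omega) hS hj) (halfB_asymmetric hn hS) φ₀

/-- **`c = (1, z)`, `n ≥ 4`**: a primitive degenerate CM type (mirror type on the half of part VI-b for `h = (0, 1)`).
[cite: Shimura1998, §8.2 Prop. 26] [cite: Gordon1999HodgeAVSurvey, §9.3] -/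
theorem exists_isPrimitive_not_isNondegenerate_dihedral₂C_of_four_le (hn : 4 ≤ n)
    (e : (K ≃ₐ[ℚ] K) ≃* DihedralGroup (2 * n) × Multiplicative (ZMod 2))
    (hc : e ((IsCMField.complexConj K).restrictScalars ℚ) = (1, Multiplicative.ofAdd 1)) (φ₀ : K →+* ℂ) :
    ∃ Φ : CMType K, IsPrimitive (ℂ ≃+* ℂ) Φ.1 φ₀ ∧ ¬ IsNondegenerate Φ := by
  haveI : NeZero n := ⟨by omega⟩
  obtain ⟨S, hS⟩ := exists_halfC n
  have hc' : e ((IsCMField.complexConj K).restrictScalars ℚ) =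
      (r (((0 : ZMod (2 * n)), (1 : ZMod 2)) : ZMod (2 * n) × ZMod 2).1,
        Multiplicative.ofAdd (((0 : ZMod (2 * n)), (1 : ZMod 2)) : ZMod (2 * n) × ZMod 2).2) := by
    rw [hc, r_zero]
  exact exists_isPrimitive_not_isNondegenerate_of_mirror₂ e _ hc' S 0 (halfC_mem_iff_add_not_mem hS)
    (fun j hj => halfC_aperiodic (by omega) hS hj) (halfC_asymmetric hn hS) φ₀

/-- **`D₄ × C₂`, `c = (r², z)`**: a primitive degenerate CM type (certificate, rank `7` of `9`). [cite: Shimura1998, §8.2 Prop. 26] -/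
theorem exists_isPrimitive_not_isNondegenerate_dihedral₂B_two
    (e : (K ≃ₐ[ℚ] K) ≃* DihedralGroup 4 × Multiplicative (ZMod 2))
    (hc : e ((IsCMField.complexConj K).restrictScalars ℚ) = (r 2, Multiplicative.ofAdd 1)) (φ₀ : K →+* ℂ) :
    ∃ Φ : CMType K, IsPrimitive (ℂ ≃+* ℂ) Φ.1 φ₀ ∧ ¬ IsNondegenerate Φ :=
  exists_isPrimitive_not_isNondegenerate_of_model_balanced e _ hc
    {(r 0, Multiplicative.ofAdd 0), (r 1, Multiplicative.ofAdd 0), (r 0, Multiplicative.ofAdd 1),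
      (r 1, Multiplicative.ofAdd 1), (sr 0, Multiplicative.ofAdd 0), (sr 1, Multiplicative.ofAdd 0),
      (sr 2, Multiplicative.ofAdd 0), (sr 3, Multiplicative.ofAdd 0)}
    (by decide) (by decide)
    {(r 0, Multiplicative.ofAdd 0), (r 1, Multiplicative.ofAdd 1), (r 2, Multiplicative.ofAdd 0),
      (r 3, Multiplicative.ofAdd 1)}
    (by decide) (by decide) φ₀

/-- **`D₄ × C₂`, `c = (1, z)`**: a primitive degenerate CM type (certificate, rank `7` of `9`). [cite: Shimura1998, §8.2 Prop. 26] -/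
theorem exists_isPrimitive_not_isNondegenerate_dihedral₂C_two
    (e : (K ≃ₐ[ℚ] K) ≃* DihedralGroup 4 × Multiplicative (ZMod 2))
    (hc : e ((IsCMField.complexConj K).restrictScalars ℚ) = (1, Multiplicative.ofAdd 1)) (φ₀ : K →+* ℂ) :
    ∃ Φ : CMType K, IsPrimitive (ℂ ≃+* ℂ) Φ.1 φ₀ ∧ ¬ IsNondegenerate Φ :=
  exists_isPrimitive_not_isNondegenerate_of_model_balanced e _ hc
    {(r 0, Multiplicative.ofAdd 0), (r 1, Multiplicative.ofAdd 0), (r 2, Multiplicative.ofAdd 0),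
      (r 3, Multiplicative.ofAdd 0), (sr 0, Multiplicative.ofAdd 0), (sr 1, Multiplicative.ofAdd 0),
      (sr 2, Multiplicative.ofAdd 1), (sr 3, Multiplicative.ofAdd 1)}
    (by decide) (by decide)
    {(r 0, Multiplicative.ofAdd 0), (r 1, Multiplicative.ofAdd 1), (r 2, Multiplicative.ofAdd 0),
      (r 3, Multiplicative.ofAdd 1)}
    (by decide) (by decide) φ₀

/-- **`D₆ × C₂`, `c = (r³, z)`**: a primitive degenerate CM type (certificate, rank `10` of `13`). [cite: Shimura1998, §8.2 Prop. 26] -/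
theorem exists_isPrimitive_not_isNondegenerate_dihedral₂B_three
    (e : (K ≃ₐ[ℚ] K) ≃* DihedralGroup 6 × Multiplicative (ZMod 2))
    (hc : e ((IsCMField.complexConj K).restrictScalars ℚ) = (r 3, Multiplicative.ofAdd 1)) (φ₀ : K →+* ℂ) :
    ∃ Φ : CMType K, IsPrimitive (ℂ ≃+* ℂ) Φ.1 φ₀ ∧ ¬ IsNondegenerate Φ :=
  exists_isPrimitive_not_isNondegenerate_of_model_balanced e _ hc
    {(r 0, Multiplicative.ofAdd 0), (r 1, Multiplicative.ofAdd 0), (r 2, Multiplicative.ofAdd 0),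
      (r 0, Multiplicative.ofAdd 1), (r 1, Multiplicative.ofAdd 1), (r 2, Multiplicative.ofAdd 1),
      (sr 0, Multiplicative.ofAdd 0), (sr 1, Multiplicative.ofAdd 0), (sr 4, Multiplicative.ofAdd 0),
      (sr 0, Multiplicative.ofAdd 1), (sr 2, Multiplicative.ofAdd 1), (sr 5, Multiplicative.ofAdd 1)}
    (by decide) (by decide)
    {(r 0, Multiplicative.ofAdd 0), (r 1, Multiplicative.ofAdd 0), (r 2, Multiplicative.ofAdd 0),
      (r 3, Multiplicative.ofAdd 0), (r 4, Multiplicative.ofAdd 0), (r 5, Multiplicative.ofAdd 0)}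
    (by decide) (by decide) φ₀

/-- **`D₆ × C₂`, `c = (1, z)`**: a primitive degenerate CM type (certificate, rank `11` of `13`). [cite: Shimura1998, §8.2 Prop. 26] -/
theorem exists_isPrimitive_not_isNondegenerate_dihedral₂C_three
    (e : (K ≃ₐ[ℚ] K) ≃* DihedralGroup 6 × Multiplicative (ZMod 2))
    (hc : e ((IsCMField.complexConj K).restrictScalars ℚ) = (1, Multiplicative.ofAdd 1)) (φ₀ : K →+* ℂ) :
    ∃ Φ : CMType K, IsPrimitive (ℂ ≃+* ℂ) Φ.1 φ₀ ∧ ¬ IsNondegenerate Φ :=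
  exists_isPrimitive_not_isNondegenerate_of_model_balanced e _ hc
    {(r 0, Multiplicative.ofAdd 0), (r 1, Multiplicative.ofAdd 0), (r 2, Multiplicative.ofAdd 0),
      (r 3, Multiplicative.ofAdd 0), (r 4, Multiplicative.ofAdd 0), (r 5, Multiplicative.ofAdd 0),
      (sr 0, Multiplicative.ofAdd 0), (sr 1, Multiplicative.ofAdd 0), (sr 2, Multiplicative.ofAdd 0),
      (sr 3, Multiplicative.ofAdd 0), (sr 4, Multiplicative.ofAdd 1), (sr 5, Multiplicative.ofAdd 1)}
    (by decide) (by decide)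
    {(r 0, Multiplicative.ofAdd 0), (r 1, Multiplicative.ofAdd 1), (r 2, Multiplicative.ofAdd 0),
      (r 3, Multiplicative.ofAdd 1), (r 4, Multiplicative.ofAdd 0), (r 5, Multiplicative.ofAdd 1)}
    (by decide) (by decide) φ₀

/-- **`c = (rⁿ, z)`, every `n ≥ 2`: a primitive degenerate CM type.** [cite: Shimura1998, §8.2 Prop. 26] [cite: Kubota1965, §2] -/
theorem exists_isPrimitive_not_isNondegenerate_dihedral₂B (hn : 2 ≤ n)
    (e : (K ≃ₐ[ℚ] K) ≃* DihedralGroup (2 * n) × Multiplicative (ZMod 2))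
    (hc : e ((IsCMField.complexConj K).restrictScalars ℚ) = (r (n : ZMod (2 * n)), Multiplicative.ofAdd 1))
    (φ₀ : K →+* ℂ) : ∃ Φ : CMType K, IsPrimitive (ℂ ≃+* ℂ) Φ.1 φ₀ ∧ ¬ IsNondegenerate Φ := by
  rcases (show n = 2 ∨ n = 3 ∨ 4 ≤ n by omega) with rfl | rfl | h4
  · simp only [Nat.cast_ofNat] at hc
    exact exists_isPrimitive_not_isNondegenerate_dihedral₂B_two e hc φ₀
  · simp only [Nat.cast_ofNat] at hc
    exact exists_isPrimitive_not_isNondegenerate_dihedral₂B_three e hc φ₀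
  · exact exists_isPrimitive_not_isNondegenerate_dihedral₂B_of_four_le h4 e hc φ₀

/-- **`c = (1, z)`, every `n ≥ 2`: a primitive degenerate CM type.** [cite: Shimura1998, §8.2 Prop. 26] [cite: Kubota1965, §2] -/
theorem exists_isPrimitive_not_isNondegenerate_dihedral₂C (hn : 2 ≤ n)
    (e : (K ≃ₐ[ℚ] K) ≃* DihedralGroup (2 * n) × Multiplicative (ZMod 2))
    (hc : e ((IsCMField.complexConj K).restrictScalars ℚ) = (1, Multiplicative.ofAdd 1)) (φ₀ : K →+* ℂ) :
    ∃ Φ : CMType K, IsPrimitive (ℂ ≃+* ℂ) Φ.1 φ₀ ∧ ¬ IsNondegenerate Φ := by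
  rcases (show n = 2 ∨ n = 3 ∨ 4 ≤ n by omega) with rfl | rfl | h4
  · exact exists_isPrimitive_not_isNondegenerate_dihedral₂C_two e hc φ₀
  · exact exists_isPrimitive_not_isNondegenerate_dihedral₂C_three e hc φ₀
  · exact exists_isPrimitive_not_isNondegenerate_dihedral₂C_of_four_le h4 e hc φ₀

/-- **… realised: a SIMPLE DEGENERATE abelian variety of dimension `4n` with CM by `K`** (`c = (rⁿ, z)` or `(1, z)`,
`n ≥ 2`). [cite: Shimura1998, §6.2 Thm. 3 and §8.2 Prop. 26] [cite: Gordon1999HodgeAVSurvey, Thm. 6.4] -/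
theorem exists_simple_degenerate_dihedral₂BC (hn : 2 ≤ n)
    (e : (K ≃ₐ[ℚ] K) ≃* DihedralGroup (2 * n) × Multiplicative (ZMod 2))
    (hc : e ((IsCMField.complexConj K).restrictScalars ℚ) = (r (n : ZMod (2 * n)), Multiplicative.ofAdd 1) ∨
      e ((IsCMField.complexConj K).restrictScalars ℚ) = (1, Multiplicative.ofAdd 1)) :
    ∃ (Φ : CMType K) (φ₀ : K →+* ℂ) (A : AbelianVariety ℂ) (ι : 𝓞 K →+* End A)
      (θ : K →+* Module.End ℂ (complexBetti A.X 1)),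
      IsPrimitive (ℂ ≃+* ℂ) Φ.1 φ₀ ∧ ¬ IsNondegenerate Φ ∧ IsCMTypeRealisation Φ A ι θ ∧ A.IsSimple ∧
      A.dim = 4 * n := by
  obtain ⟨φ₀⟩ := (inferInstance : Nonempty (K →+* ℂ))
  obtain ⟨Φ, hprim, hdeg⟩ : ∃ Φ : CMType K, IsPrimitive (ℂ ≃+* ℂ) Φ.1 φ₀ ∧ ¬ IsNondegenerate Φ := by
    rcases hc with hc | hc
    · exact exists_isPrimitive_not_isNondegenerate_dihedral₂B hn e hc φ₀
    · exact exists_isPrimitive_not_isNondegenerate_dihedral₂C hn e hc φ₀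
  obtain ⟨A, ι, θ, hA, hs, hdim⟩ := exists_simple_realisation_of_isPrimitive Φ φ₀ hprim
  refine ⟨Φ, φ₀, A, ι, θ, hprim, hdeg, hA, hs, ?_⟩
  rw [hdim, finrank_eq_eight_mul e]
  omega

/-! ## §2 The classification for `c = (rⁿ, z)` and `c = (1, z)`: good ⟺ `n = 1` -/

/-- **`c = (rⁿ, z)` or `(1, z)`: every PRIMITIVE CM type nondegenerate ⟺ `n = 1`.** [cite: Kubota1965, §2]
[cite: Shimura1998, §8.2 Prop. 26] [cite: Dodson1984, §3.3.2] -/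
theorem forall_isPrimitive_isNondegenerate_iff_dihedral₂BC
    (e : (K ≃ₐ[ℚ] K) ≃* DihedralGroup (2 * n) × Multiplicative (ZMod 2))
    (hc : e ((IsCMField.complexConj K).restrictScalars ℚ) = (r (n : ZMod (2 * n)), Multiplicative.ofAdd 1) ∨
      e ((IsCMField.complexConj K).restrictScalars ℚ) = (1, Multiplicative.ofAdd 1)) :
    (∀ (Φ : CMType K) (φ₀ : K →+* ℂ), IsPrimitive (ℂ ≃+* ℂ) Φ.1 φ₀ → IsNondegenerate Φ) ↔ n = 1 := by
  have hK := finrank_eq_eight_mul e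
  have hpos := pos_of_mulEquiv₂ e
  refine ⟨fun h => ?_, fun hn Φ φ₀ hprim => ?_⟩
  · by_contra hne
    obtain ⟨φ₀⟩ := (inferInstance : Nonempty (K →+* ℂ))
    obtain ⟨Φ, hprim, hdeg⟩ : ∃ Φ : CMType K, IsPrimitive (ℂ ≃+* ℂ) Φ.1 φ₀ ∧ ¬ IsNondegenerate Φ := by
      rcases hc with hc | hc
      · exact exists_isPrimitive_not_isNondegenerate_dihedral₂B (by omega) e hc φ₀
      · exact exists_isPrimitive_not_isNondegenerate_dihedral₂C (by omega) e hc φ₀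
    exact hdeg (h Φ φ₀ hprim)
  · subst hn
    exact GaloisDodecic.isNondegenerate_of_isPrimitive_of_finrank_le_twelve (by omega) (fun _ => inferInstance)
      (fun h12 => by omega) φ₀ hprim

/-- **`c = (rⁿ, z)` or `(1, z)`: every SIMPLE abelian variety with CM by `K` nondegenerate ⟺ `n = 1`.**
[cite: Gordon1999HodgeAVSurvey, Thm. 6.4] [cite: Shimura1998, §6.2 Thm. 3 and §8.2 Prop. 26] -/
theorem forall_isSimple_isNondegenerate_iff_dihedral₂BC
    (e : (K ≃ₐ[ℚ] K) ≃* DihedralGroup (2 * n) × Multiplicative (ZMod 2))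
    (hc : e ((IsCMField.complexConj K).restrictScalars ℚ) = (r (n : ZMod (2 * n)), Multiplicative.ofAdd 1) ∨
      e ((IsCMField.complexConj K).restrictScalars ℚ) = (1, Multiplicative.ofAdd 1)) :
    (∀ (Φ : CMType K) (A : AbelianVariety ℂ) (ι : 𝓞 K →+* End A) (θ : K →+* Module.End ℂ (complexBetti A.X 1)),
      IsCMTypeRealisation Φ A ι θ → A.IsSimple → IsNondegenerate Φ) ↔ n = 1 := by
  rw [← forall_isPrimitive_isNondegenerate_iff_dihedral₂BC e hc]
  constructor
  · intro h Φ φ₀ hprim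
    obtain ⟨A, ι, θ, hA, hs, -⟩ := exists_simple_realisation_of_isPrimitive Φ φ₀ hprim
    exact h Φ A ι θ hA hs
  · intro h Φ A ι θ hA hs
    obtain ⟨φ₀⟩ := (inferInstance : Nonempty (K →+* ℂ))
    exact h Φ φ₀ ((isSimple_iff_isPrimitive hA φ₀).1 hs)

/-- **`c = (rⁿ, z)` or `(1, z)`: every `X` with `K ↪ End⁰(X)`, `[K:ℚ] = 2 dim X`, stably nondegenerate ⟺ `n = 1`.**
[cite: Gordon1999HodgeAVSurvey, Thm. 6.4 and Def. 7.6] [cite: Shimura1998, §8.2 Prop. 26] -/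
theorem forall_isStablyNondegenerate_iff_dihedral₂BC
    (e : (K ≃ₐ[ℚ] K) ≃* DihedralGroup (2 * n) × Multiplicative (ZMod 2))
    (hc : e ((IsCMField.complexConj K).restrictScalars ℚ) = (r (n : ZMod (2 * n)), Multiplicative.ofAdd 1) ∨
      e ((IsCMField.complexConj K).restrictScalars ℚ) = (1, Multiplicative.ofAdd 1)) :
    (∀ (X : AbelianVariety ℂ) (_ : K →+* X.endAlgebra), Module.finrank ℚ K = 2 * X.dim → IsStablyNondegenerate X) ↔
      n = 1 := by
  have hK := finrank_eq_eight_mul e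
  have hpos := pos_of_mulEquiv₂ e
  refine ⟨fun h => ?_, fun hn X φ hX => ?_⟩
  · by_contra hne
    obtain ⟨Φ, φ₀, A, ι, θ, hprim, hdeg, hA, -, -⟩ := exists_simple_degenerate_dihedral₂BC (by omega) e hc
    obtain ⟨i, -⟩ := exists_ringHom_endAlgebra ι
    exact hdeg ((isStablyNondegenerate_iff_isNondegenerate φ₀ hprim hA).1
      (h A i (finrank_eq_two_mul_dim_of_isCMTypeRealisation hA)))
  · subst hn
    exact SmallDegreeAllTypes.isStablyNondegenerate_of_finrank_le_twelve (by omega) (fun _ => inferInstance)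
      (fun h12 => by omega) φ hX

/-! ## §3 Every central involution: the combined classification -/

/-- **The image of complex conjugation is one of the three central involutions** `(rⁿ, 1)`, `(1, z)`, `(rⁿ, z)`
(`n ≥ 2`). [cite: Shimura1998, §18.2 Lemma (i)] -/
theorem central_involution_cases (hn : 2 ≤ n) (e : (K ≃ₐ[ℚ] K) ≃* DihedralGroup (2 * n) × Multiplicative (ZMod 2)) :
    e ((IsCMField.complexConj K).restrictScalars ℚ) = (r (n : ZMod (2 * n)), 1) ∨
      e ((IsCMField.complexConj K).restrictScalars ℚ) = (r (n : ZMod (2 * n)), Multiplicative.ofAdd 1) ∨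
      e ((IsCMField.complexConj K).restrictScalars ℚ) = (1, Multiplicative.ofAdd 1) := by
  set c₀ := e ((IsCMField.complexConj K).restrictScalars ℚ) with hc₀
  have hsq : c₀ * c₀ = 1 := model_complexConj_mul_self e rfl
  have hne : c₀ ≠ 1 := model_complexConj_ne_one e rfl
  have hcomm : ∀ y, c₀ * y = y * c₀ := model_complexConj_comm e rfl
  obtain ⟨d, w⟩ := c₀
  have hd2 : d * d = 1 := by have := congrArg Prod.fst hsq; simpa using this
  have hdcomm : ∀ y : DihedralGroup (2 * n), d * y = y * d := fun y => by
    have := congrArg Prod.fst (hcomm (y, 1)); simpa using this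
  have hw : w = 1 ∨ w = Multiplicative.ofAdd 1 := by
    rcases Summit.HodgeConjecture.CorCM.TwoGroupPieces.zmod_two_cases (Multiplicative.toAdd w) with h | h
    · exact Or.inl (by rw [← ofAdd_toAdd w, h, ofAdd_zero])
    · exact Or.inr (by rw [← ofAdd_toAdd w, h])
  by_cases hd : d = 1
  · subst hd
    rcases hw with rfl | rfl
    · exact absurd rfl hne
    · exact Or.inr (Or.inr rfl)
  · have hdr := GaloisDihedral.eq_r_of_central_involution hn d hd2 hd hdcomm
    subst hdr
    rcases hw with rfl | rfl
    · exact Or.inl rfl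
    · exact Or.inr (Or.inl rfl)

/-- **THE COMBINED CLASSIFICATION of the family `D_{2n} × C₂` (every central involution).**  `K` Galois CM,
`e : Gal(K/ℚ) ≃* DihedralGroup (2n) × Multiplicative (ZMod 2)`: every SIMPLE abelian variety with complex multiplication
by `K` is NONDEGENERATE ⟺ `n = 1`, or `n = 2` and complex conjugation is `(r², 1)` (order `16`, `GOOD16`).
[cite: Gordon1999HodgeAVSurvey, Thm. 6.4] [cite: Shimura1998, §6.2 Thm. 3 and §8.2 Prop. 26] [cite: Dodson1984, §3.3.2] -/
theorem forall_isSimple_isNondegenerate_iff_dihedral₂_all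
    (e : (K ≃ₐ[ℚ] K) ≃* DihedralGroup (2 * n) × Multiplicative (ZMod 2)) :
    (∀ (Φ : CMType K) (A : AbelianVariety ℂ) (ι : 𝓞 K →+* End A) (θ : K →+* Module.End ℂ (complexBetti A.X 1)),
      IsCMTypeRealisation Φ A ι θ → A.IsSimple → IsNondegenerate Φ) ↔
      (n = 1 ∨ (n = 2 ∧ e ((IsCMField.complexConj K).restrictScalars ℚ) = (r (n : ZMod (2 * n)), 1))) := by
  have hK := finrank_eq_eight_mul e
  have hpos := pos_of_mulEquiv₂ e
  by_cases h1 : n = 1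
  · subst h1
    refine ⟨fun _ => Or.inl rfl, fun _ Φ A ι θ hA hs => ?_⟩
    obtain ⟨φ₀⟩ := (inferInstance : Nonempty (K →+* ℂ))
    exact GaloisDodecic.isNondegenerate_of_isPrimitive_of_finrank_le_twelve (by omega) (fun _ => inferInstance)
      (fun h12 => by omega) φ₀ ((isSimple_iff_isPrimitive hA φ₀).1 hs)
  · rcases central_involution_cases (by omega) e with hc | hc | hc
    · rw [forall_isSimple_isNondegenerate_iff_dihedral₂ e hc]
      constructor
      · intro h2; exact Or.inr ⟨by omega, hc⟩
      · rintro (h | ⟨h, -⟩) <;> omega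
    · rw [forall_isSimple_isNondegenerate_iff_dihedral₂BC e (Or.inl hc)]
      constructor
      · intro h; exact absurd h h1
      · rintro (h | ⟨-, h⟩)
        · exact absurd h h1
        · rw [hc] at h
          have h2 := congrArg Prod.snd h
          dsimp only at h2
          exact absurd h2 (by decide)
    · rw [forall_isSimple_isNondegenerate_iff_dihedral₂BC e (Or.inr hc)]
      constructor
      · intro h; exact absurd h h1
      · rintro (h | ⟨-, h⟩)
        · exact absurd h h1
        · rw [hc] at h
          have h2 := congrArg Prod.snd h
          dsimp only at h2
          exact absurd h2 (by decide)

end Summit.HodgeConjecture.CorCM.GaloisDihedralTimesTwo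

end
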